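import Summits.AtomisticToContinuum.FouriersLaw.Theses.ContactStieltjesMeasure

/-!
# Transfer lemma for line `frictiongrid` of crux `ContactUpperDensity` (stmt-AtomisticToContinuum-15249)

Sorry-free companion of `Lines/frictiongrid.lean` (strategist). It records, kernel-checked, that the
load-bearing stub `stub_dyadicFrictionResponse` of that line AT ONE FIXED FRICTION is exactly the
shared bounded-response item `BoundedResponse` (stmt-AtomisticToContinuum-11071, route
FeketeSeriesLaw; = `Literature.Barriers.AtomisticToContinuum.HasBoundedResponse (pinnedChain …)`
written out): what the stub adds over 11071 is ONLY the uniformity of the constant along the dyadic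
frictions `γ = 2^k ≤ N`. The hypothesis is written out verbatim (no import of another route file).
-/

namespace Summit.AtomisticToContinuum.FouriersLaw.Cruxes.ContactUpperDensity.FrictionGrid

open MeasureTheory Filter Set
open scoped Topology

/-! ## Transfer (sorry-free): each grid level at FIXED friction is the shared bounded-response item -/

/-- TRANSFER LEMMA (sorry-free). Hypothesis = the shared item `BoundedResponse`
(stmt-AtomisticToContinuum-11071, route FeketeSeriesLaw; statement written out verbatim: along
every steady-state family, if the response limits `D_N` exist then `(|D_N|)_N` is bounded).
Conclusion: for every representing family `Φ` and EVERY fixed friction `γ > 0` there is `C_γ`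
with `(N-1)·γ·∫₀^∞ Φ_N w_γ ≤ C_γ` for all `N ≥ 2` — i.e. `stub_dyadicFrictionResponse` at one
fixed grid level. Proof: the canonical steady family (`pinnedChain_exists_isSteadyState`, choice)
and weak-NESS uniqueness (`Theorems.nessUnique_proof`, stmt-0741, PROVED) identify
`D_N(γ) := (N-1)γ∫Φ_N w_γ` (`N ≥ 2`; `0` for `N ≤ 1`, no bonds) as response limits; 11071 bounds
them. What the stub adds over 11071 is ONLY the uniformity of `C_γ` along `γ = 2^k ≤ N`. -/
theorem gridPointwise_of_boundedResponse
    (hBR : ∀ ω₂ lam β γ : ℝ, 0 < ω₂ → 0 < lam → 0 < β → 0 < γ → ∀ μ : (N : ℕ) → ℝ → ℝ → MeasureTheory.Measure (Literature.MathematicalPhysics.KineticTheory.HeatConduction.PhaseSpace N), (∀ (N : ℕ) (T_L T_R : ℝ), 0 < T_L → 0 < T_R → (Literature.MathematicalPhysics.KineticTheory.HeatConduction.pinnedChain ω₂ lam β γ).IsSteadyState N T_L T_R (μ N T_L T_R)) → ∀ T : ℝ, 0 < T → ∀ D : ℕ → ℝ, (∀ N : ℕ, Filter.Tendsto (fun δ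 : ℝ => (Literature.MathematicalPhysics.KineticTheory.HeatConduction.pinnedChain ω₂ lam β γ).totalCurrent (μ N (T + δ / 2) (T - δ / 2)) / δ) (nhdsWithin 0 {(0 : ℝ)}ᶜ) (nhds (D N))) → BddAbove (Set.range fun N => |D N|)) :
    ∀ ω₂ lam β : ℝ, 0 < ω₂ → 0 < lam → 0 < β → ∀ T : ℝ, 0 < T → ∀ Φ : ℕ → ℝ → ℝ, (∀ N : ℕ, 2 ≤ N → Monotone (Φ N) ∧ (∀ s : ℝ, s ≤ 0 → Φ N s = 0) ∧ (∃ m : ℝ, ∀ s : ℝ, Φ N s ≤ m) ∧ ∀ γ : ℝ, 0 < γ → (∀ (N' : ℕ) (T_L T_R : ℝ), 0 < T_L → 0 < T_R → ∀ μ ν : MeasureTheory.Measure (Literature.MathematicalPhysics.KineticTheory.HeatConduction.PhaseSpace N'), (Literature.MathematicalPhysics.KineticTheory.HeatConduction.pinnedChain ω₂ lam β γ).IsSteadyState N' T_L T_R μ → (Literature.MathematicalPhysics.KineticTheory.HeatConduction.pinnedChain ω₂ lam β γ).IsSteadyState N' T_L T_R ν → μ = ν) → ∀ μ : (N' : ℕ)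 → ℝ → ℝ → MeasureTheory.Measure (Literature.MathematicalPhysics.KineticTheory.HeatConduction.PhaseSpace N'), (∀ (N' : ℕ) (T_L T_R : ℝ), 0 < T_L → 0 < T_R → (Literature.MathematicalPhysics.KineticTheory.HeatConduction.pinnedChain ω₂ lam β γ).IsSteadyState N' T_L T_R (μ N' T_L T_R)) → Filter.Tendsto (fun δ : ℝ => (Literature.MathematicalPhysics.KineticTheory.HeatConduction.pinnedChain ω₂ lam β γ).totalCurrent (μ N (T + δ / 2) (T - δ / 2)) / δ) (nhdsWithin 0 {(0 : ℝ)}ᶜ) (nhds (((N : ℝ) - 1) * γ * ∫ t in Set.Ioi (0 : ℝ), Φ N t * (2 * t / (γ ^ 2 + t ^ 2) ^ 2)))) → ∀ γ : ℝ, 0 < γ → ∃ Cγ : ℝ, ∀ N : ℕ, 2 ≤ N → ((N : ℝ) - 1) * γ * ∫ t in Set.Ioi (0 : ℝ), Φ N t * (2 * t / (γ ^ 2 + t ^ 2) ^ 2) ≤ Cγ := by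
  intro ω₂ lam β hω hl hβ T hT Φ hΦ γ hγ
  have hU : Summit.AtomisticToContinuum.FouriersLaw.Theses.EmbeddedDrudeMourre.NessUnique :=
    Summit.AtomisticToContinuum.FouriersLaw.Theorems.nessUnique_proof
  have huniq := hU ω₂ lam β γ hω hl hβ hγ
  have hex := fun (N : ℕ) (T_L T_R : ℝ) (hL : 0 < T_L) (hR : 0 < T_R) =>
    Literature.MathematicalPhysics.KineticTheory.HeatConduction.pinnedChain_exists_isSteadyState hω hl hβ hγ N hL hR
  classical
  let μ₀ : (N : ℕ) → ℝ → ℝ →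
      MeasureTheory.Measure (Literature.MathematicalPhysics.KineticTheory.HeatConduction.PhaseSpace N) :=
    fun N T_L T_R => if h : 0 < T_L ∧ 0 < T_R then Classical.choose (hex N T_L T_R h.1 h.2) else 0
  have hμ₀ : ∀ (N : ℕ) (T_L T_R : ℝ), 0 < T_L → 0 < T_R →
      (Literature.MathematicalPhysics.KineticTheory.HeatConduction.pinnedChain ω₂ lam β γ).IsSteadyState N T_L T_R
        (μ₀ N T_L T_R) := by
    intro N T_L T_R hL hR
    simp only [μ₀, dif_pos (And.intro hL hR)]
    exact Classical.choose_spec (hex N T_L T_R hL hR)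
  let D : ℕ → ℝ := fun N => if 2 ≤ N then
    ((N : ℝ) - 1) * γ * ∫ t in Set.Ioi (0 : ℝ), Φ N t * (2 * t / (γ ^ 2 + t ^ 2) ^ 2) else 0
  have hDN : ∀ N : ℕ, 2 ≤ N →
      D N = ((N : ℝ) - 1) * γ * ∫ t in Set.Ioi (0 : ℝ), Φ N t * (2 * t / (γ ^ 2 + t ^ 2) ^ 2) :=
    fun N hN => if_pos hN
  have hD : ∀ N : ℕ, Filter.Tendsto (fun δ : ℝ =>
      (Literature.MathematicalPhysics.KineticTheory.HeatConduction.pinnedChain ω₂ lam β γ).totalCurrent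
        (μ₀ N (T + δ / 2) (T - δ / 2)) / δ) (nhdsWithin 0 {(0 : ℝ)}ᶜ) (nhds (D N)) := by
    intro N
    by_cases hN : 2 ≤ N
    · rw [hDN N hN]
      exact (hΦ N hN).2.2.2 γ hγ huniq μ₀ hμ₀
    · have hD0 : D N = 0 := if_neg hN
      rw [hD0]
      have hj : ∀ (i : Fin N) (x : Literature.MathematicalPhysics.KineticTheory.HeatConduction.PhaseSpace N),
          (Literature.MathematicalPhysics.KineticTheory.HeatConduction.pinnedChain ω₂ lam β γ).bondCurrent N i x = 0 :=
        fun i x => by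
          unfold Literature.MathematicalPhysics.KineticTheory.HeatConduction.OscillatorChain.bondCurrent
          refine Finset.sum_eq_zero fun j _ => ?_
          have hji : ¬ (j.val = i.val + 1) := by have := j.isLt; omega
          rw [if_neg hji]
      have e : (fun δ : ℝ =>
          (Literature.MathematicalPhysics.KineticTheory.HeatConduction.pinnedChain ω₂ lam β γ).totalCurrent
            (μ₀ N (T + δ / 2) (T - δ / 2)) / δ) = fun _ => 0 := by
        funext δ
        have : (Literature.MathematicalPhysics.KineticTheory.HeatConduction.pinnedChain ω₂ lam β γ).totalCurrent
            (μ₀ N (T + δ / 2) (T - δ / 2)) = 0 := by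
          unfold Literature.MathematicalPhysics.KineticTheory.HeatConduction.OscillatorChain.totalCurrent
          exact Finset.sum_eq_zero fun i _ => by simp only [hj, MeasureTheory.integral_zero]
        rw [this, zero_div]
      rw [e]
      exact tendsto_const_nhds
  obtain ⟨S, hS⟩ := hBR ω₂ lam β γ hω hl hβ hγ μ₀ hμ₀ T hT D hD
  refine ⟨S, fun N hN => ?_⟩
  have h1 : |D N| ≤ S := hS (Set.mem_range_self (f := fun N => |D N|) N)
  calc ((N : ℝ) - 1) * γ * ∫ t in Set.Ioi (0 : ℝ), Φ N t * (2 * t / (γ ^ 2 + t ^ 2) ^ 2)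
        = D N := (hDN N hN).symm
    _ ≤ |D N| := le_abs_self _
    _ ≤ S := h1

end Summit.AtomisticToContinuum.FouriersLaw.Cruxes.ContactUpperDensity.FrictionGrid
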